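import Summits.ValiantsHypothesis.ValiantsHypothesis.Theorems.BarrierLeverAnchoredDoorHitsLowerPairsRelabel

/-!
# Support item `AnchoredDoorHitsLowerPairs` (stmt-ValiantsHypothesis-22510), line `anchored-peeling`:
# HEREDITARY DC — column sub-complexes of `K_{2^{k+1}−1}` with their DESIGNATED rows; the EVEN CUBE versus the COMPLETE BIPARTITE GRAPH

Helper file (`--supports stmt-ValiantsHypothesis-22510`; cell valiant-natproofs, rung V4, 𝒟-side door (c); registered line
`Cruxes/AnchoredDoorHitsLowerPairs/Lines/anchored_peeling.lean` v20/v21; planner mandate val-np-p1 g23 (2) («extend the decrement template … each proved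
sub-family enters as a further glued split (typed family predicate + arrow)»); prover seat val-np-p1 gen 23; builds on `…DecrementGeneral` (p654147,
`stub_decrementFamily`) and `…Relabel` (p654443)). Two family predicates (`BipRow`, `BipCol`). Closes NO item.

WHAT. (1) **HEREDITARY DC** (`DecFamily.symbolicDet_one_ne_zero_of_desc`): the key-form certificate of the canonical pair restricts to ANY sub-family of columns
of `K_{2^{k+1}−1}` (valid descriptors `desc j` with `colOf k (desc j) = w j`, `w` injective) against any row enumeration containing their DESIGNATED rows
`dRow k (desc j)`: the profile-1 symbolic minor is nonzero. (A sub-matrix of a triangular matrix through diagonal positions is triangular; no lower-set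
hypothesis is needed for the algebra.) `stub_decrementFamily` is the case of all columns.
(2) **THE EVEN CUBE VERSUS THE COMPLETE BIPARTITE GRAPH** (`symbolicDet_one_ne_zero_bipartite`): the class-0, `ω`-free part of the canonical pair — rows
`BipRow k h` = ALL faces of the cube on the `2k` variables `{0..2k} ∖ {k}` (the `(S, 0, T)`), columns `BipCol k h` = the faces of size `≤ 2` of the complete
bipartite graph `K_{2^k−1, 2^k−1}` between the `γ`- and the `δ`-vertices (`∅`, `γ_P ↦ (P,0,∅)`, `δ_Q ↦ (∅,0,Q)`, `γ_Pδ_Q ↦ (P,0,Q)`; `(2^k)^2 = 2^{2k}` faces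
on both sides) — is hit at profile 1 for EVERY `k`, and so is every relabelled copy (`symbolicDet_one_ne_zero_bipartite_relab`).

WHAT THIS IS NOT: no claim that these pairs are members of the face-UQ residual; nothing on crux stmt-ValiantsHypothesis-14610 or on `VP` versus `VNP`.
-/

set_option linter.dupNamespace false

namespace Summit.ValiantsHypothesis.ValiantsHypothesis.Theorems.BarrierLever.AnchoredPeeling

open Finset

variable {h : ℕ}

namespace DecFamily

/-! ## 1. Hereditary DC: any column sub-family with its designated rows -/

/-- **HEREDITARY DC.** For `2k+1 ≤ h`, `2^{k+1}−1 ≤ h`: if `w` is an injective family of columns of `K_{2^{k+1}−1}` described by valid descriptors `desc`, and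
every designated row `dRow k (desc j)` occurs in the row family `u` (same index type), then `symbolicDet 1 h r u w ≠ 0`. -/
theorem symbolicDet_one_ne_zero_of_desc (k h r : ℕ) (u w : Fin r → Finset (Fin h)) (desc : Fin r → Col) (hkh : 2 * k + 1 ≤ h)
    (hKh : 2 ^ (k + 1) - 1 ≤ h) (hw : Function.Injective w) (hvalid : ∀ j, (desc j).Valid k) (hcol : ∀ j, colOf k (desc j) = w j)
    (hrow : ∀ j, ∃ i, u i = dRow k (desc j)) : symbolicDet 1 h r u w ≠ 0 := by
  classical
  choose dj hdj using hrow
  have hinj : Function.Injective dj := by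
    intro j j' hjj
    have h1 : dRow (h := h) k (desc j) = dRow k (desc j') := by rw [← hdj j, ← hdj j', hjj]
    have h2 : desc j = desc j' := eq_of_dRow_eq (hvalid j) (hvalid j') hkh h1
    apply hw
    rw [← hcol j, ← hcol j', h2]
  let d : Equiv.Perm (Fin r) := Equiv.ofBijective dj (Finite.injective_iff_bijective.mp hinj)
  refine symbolicDet_one_ne_zero_of_key u w (roots k) (tails k) d (fun j => (desc j).key k) ?_ ?_ ?_
  · intro j j' hjj
    have h2 : desc j = desc j' := eq_of_key_eq (hvalid j) (hvalid j') hjj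
    apply hw
    rw [← hcol j, ← hcol j', h2]
  · intro j
    show DoorSupp (roots k) (tails k) (w j) (u (dj j))
    rw [hdj j, ← hcol j]
    exact doorSupp_dRow (hvalid j) hkh hKh
  · intro j j' hsupp
    change DoorSupp (roots k) (tails k) (w j) (u (dj j')) at hsupp
    rw [hdj j', ← hcol j] at hsupp
    rcases supp_key (hvalid j) hkh hKh hsupp with heq | hlt
    · rw [eq_of_dRow_eq (hvalid j') (hvalid j) hkh heq]
    · rw [own_dRow (hvalid j') hkh] at hlt
      exact hlt.le

end DecFamily

/-! ## 2. The even cube versus the complete bipartite graph -/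

/-- A row of the bipartite pair at level `k`: a face of the cube on the `2k` variables `0..2k` other than `k` (the rows `(S, 0, T)` of the canonical pair). -/
def BipRow (k h : ℕ) (U : Finset (Fin h)) : Prop :=
  ∀ x ∈ U, x.val ≤ 2 * k ∧ x.val ≠ k

/-- A column of the bipartite pair at level `k`: a face of size `≤ 2` of the complete bipartite graph `K_{2^k−1, 2^k−1}` between the `γ`-vertices (values
`< 2^k − 1`) and the `δ`-vertices (values `2^k .. 2^{k+1}−2`): a column of the canonical pair avoiding `ω` (value `2^k − 1`) with at most one vertex per side. -/
def BipCol (k h : ℕ) (W : Finset (Fin h)) : Prop :=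
  DecCol k h W ∧ (∀ y ∈ W, y.val + 1 ≠ 2 ^ k) ∧
    (∀ y ∈ W, ∀ y' ∈ W, y.val + 1 < 2 ^ k → y'.val + 1 < 2 ^ k → y = y') ∧
    (∀ y ∈ W, ∀ y' ∈ W, 2 ^ k < y.val + 1 → 2 ^ k < y'.val + 1 → y = y')

/-- Rows `(S, 0, T)` with index sets in `range k` are rows of the bipartite pair. -/
theorem bipRow_rowOf {k : ℕ} {S T : Finset ℕ} (hT : T ⊆ range k) : BipRow k h (DecFamily.rowOf k S false T) := by
  intro x hx
  rcases DecFamily.mem_rowOf.mp hx with ⟨h1, _⟩ | ⟨_, h2⟩ | ⟨h3, h4⟩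
  · exact ⟨by omega, by omega⟩
  · exact absurd h2 Bool.false_ne_true
  · have := mem_range.mp (hT h4); exact ⟨by omega, by omega⟩

/-- **A column of the bipartite pair is `∅`, a `γ`-vertex, a `δ`-vertex or a cross**, and its designated row is a row of the bipartite pair. -/
theorem exists_desc_of_bipCol {k : ℕ} {W : Finset (Fin h)} (hW : BipCol k h W) (hKh : 2 ^ (k + 1) - 1 ≤ h) :
    ∃ d : DecFamily.Col, d.Valid k ∧ DecFamily.colOf k d = W ∧ BipRow k h (DecFamily.dRow k d) := by
  obtain ⟨hdec, hnoω, hγ, hδ⟩ := hW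
  obtain ⟨d, hd, hcol⟩ := DecFamily.exists_col_of_decCol hdec
  have hpow : 2 ^ (k + 1) = 2 * 2 ^ k := by rw [pow_succ]; ring
  have h1k : 1 ≤ 2 ^ k := Nat.one_le_two_pow
  -- a vertex with number `c` lies in `W` iff `c ∈ d.verts k`
  have hmem : ∀ c (hc : 1 ≤ c) (hch : c ≤ h), c ∈ d.verts k → (⟨c - 1, by omega⟩ : Fin h) ∈ W := by
    intro c hc hch hcv
    rw [← hcol, DecFamily.mem_colOf]
    have : c - 1 + 1 = c := by omega
    simp only [this]; exact hcv
  refine ⟨d, hd, hcol, ?_⟩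
  cases d with
  | empty => simp only [DecFamily.dRow, DecFamily.Col.dtrip]; exact bipRow_rowOf (empty_subset _)
  | gam P => simp only [DecFamily.dRow, DecFamily.Col.dtrip]; exact bipRow_rowOf (empty_subset _)
  | del Q => simp only [DecFamily.dRow, DecFamily.Col.dtrip]; exact bipRow_rowOf (DecFamily.bits_subset_range hd.2)
  | cross P Q => simp only [DecFamily.dRow, DecFamily.Col.dtrip]; exact bipRow_rowOf (DecFamily.bits_subset_range hd.2.2.2)
  | om =>
    exfalso
    have hv := hmem (2 ^ k) h1k (by omega) (by simp [DecFamily.Col.verts])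
    exact hnoω _ hv (by simp only []; omega)
  | omGam P =>
    exfalso
    have hv := hmem (2 ^ k) h1k (by omega) (by simp [DecFamily.Col.verts])
    exact hnoω _ hv (by simp only []; omega)
  | omDel Q =>
    exfalso
    have hv := hmem (2 ^ k) h1k (by omega) (by simp [DecFamily.Col.verts])
    exact hnoω _ hv (by simp only []; omega)
  | gg P P' =>
    exfalso
    obtain ⟨hP, hPP', hP'⟩ := hd
    have hv := hmem P hP (by omega) (by simp [DecFamily.Col.verts])
    have hv' := hmem P' (by omega) (by omega) (by simp [DecFamily.Col.verts])
    have := hγ _ hv _ hv' (by simp only []; omega) (by simp only []; omega)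
    rw [Fin.ext_iff] at this; simp only [] at this; omega
  | dd Q Q' =>
    exfalso
    obtain ⟨hQ, hQQ', hQ'⟩ := hd
    have hv := hmem (2 ^ k + Q) (by omega) (by omega) (by simp [DecFamily.Col.verts])
    have hv' := hmem (2 ^ k + Q') (by omega) (by omega) (by simp [DecFamily.Col.verts])
    have := hδ _ hv _ hv' (by simp only []; omega) (by simp only []; omega)
    rw [Fin.ext_iff] at this; simp only [] at this; omega

/-- **THE EVEN CUBE VERSUS THE COMPLETE BIPARTITE GRAPH IS HIT AT PROFILE 1, for every `k`.** For `2k+1 ≤ h`, `2^{k+1} − 1 ≤ h`: every injective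
enumeration `w` of columns in `BipCol k h` (faces of size `≤ 2` of `K_{2^k−1,2^k−1}`) against any row enumeration `u` of the same length containing every
face of the `2k`-cube `BipRow k h` has nonzero profile-1 symbolic minor. -/
theorem symbolicDet_one_ne_zero_bipartite (k h r : ℕ) (u w : Fin r → Finset (Fin h)) (hkh : 2 * k + 1 ≤ h) (hKh : 2 ^ (k + 1) - 1 ≤ h)
    (hw : Function.Injective w) (hU : ∀ U : Finset (Fin h), BipRow k h U → U ∈ Set.range u) (hW : ∀ j, BipCol k h (w j)) :
    symbolicDet 1 h r u w ≠ 0 := by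
  have hdesc : ∀ j, ∃ d : DecFamily.Col, d.Valid k ∧ DecFamily.colOf k d = w j ∧ BipRow k h (DecFamily.dRow k d) :=
    fun j => exists_desc_of_bipCol (hW j) hKh
  choose desc hvalid hcol hrow using hdesc
  exact DecFamily.symbolicDet_one_ne_zero_of_desc k h r u w desc hkh hKh hw hvalid hcol (fun j => by
    obtain ⟨i, hi⟩ := hU _ (hrow j); exact ⟨i, hi⟩)

/-- **The bipartite family up to relabelling.** The same conclusion when rows and columns are relabelled by permutations `σ`, `τ` of `Fin h`. -/
theorem symbolicDet_one_ne_zero_bipartite_relab (k h r : ℕ) (u w : Fin r → Finset (Fin h)) (σ τ : Equiv.Perm (Fin h)) (hkh : 2 * k + 1 ≤ h)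
    (hKh : 2 ^ (k + 1) - 1 ≤ h) (hw : Function.Injective w)
    (hU : ∀ U : Finset (Fin h), BipRow k h (U.map σ.toEmbedding) → U ∈ Set.range u) (hW : ∀ j, BipCol k h ((w j).map τ.toEmbedding)) :
    symbolicDet 1 h r u w ≠ 0 := by
  rw [← symbolicDet_ne_zero_relab_iff σ τ]
  refine symbolicDet_one_ne_zero_bipartite k h r _ _ hkh hKh (fun j j' hjj => hw (Finset.map_injective _ hjj)) (fun U hD => ?_) hW
  have hpre : (U.map σ.symm.toEmbedding).map σ.toEmbedding = U := by
    rw [Finset.map_map]; convert Finset.map_refl (s := U) using 2; ext x; simp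
  obtain ⟨i, hi⟩ := hU (U.map σ.symm.toEmbedding) (by rw [hpre]; exact hD)
  exact ⟨i, by simp only []; rw [hi, hpre]⟩

end Summit.ValiantsHypothesis.ValiantsHypothesis.Theorems.BarrierLever.AnchoredPeeling
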